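import Summits.QuantumFields.BalabanUV.T4Continuum.Support.AbelianCovariantLaplacian
import Summits.QuantumFields.BalabanUV.T4Continuum.Support.KroneckerUnits

/-!
# T⁴ programme, spine node NE2 (U1a) — THE NON-ABELIAN COVARIANT LAPLACIAN: `Δ^R − Δ^1 ⊗ 1 = F + Fᴴ + siteMul z` EXACTLY and
# its η-rate by REDUCTION TO TIER A along matrix units (tier B, row B2 of `t4/SKELETON-NE2-P1.md`)

Ninth generation of the NE2 prover lineage P1 of the cell `pub-balaban`, file 19 (on top of files 14, 18).  Row B2 of the skeleton
WITHOUT re-doing any analysis: for colour transporters `R_ν(x) ∈ M_o(ℂ)` (e.g. the adjoint representation of `U(x, x + e_ν)`),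

 * §1 `covDc c R ν = c·(siteMul (R ν)·(S_ν ⊗ 1) − 1)` (covariant forward difference on `(sites × components) × colours`),
   `connM = c(R − 1)`, `covDc_eq : covDc = ∇ ⊗ 1 + siteMul (c(R − 1))·(S ⊗ 1)`, `covLapC = Σ (covDc)ᴴ covDc`, `lapC = Σ (∇⊗1)ᴴ(∇⊗1)`;
 * §2 (real lattice factor `c = n`) the exact identities `(∇⊗1)ᴴ·siteMul w·(S⊗1) = −siteMul w·(∇⊗1) − c(siteMul w − siteMul w₋)`,
   `(siteMul w (S⊗1))ᴴ(siteMul w (S⊗1)) = siteMul ((wᴴw) ∘ τ⁻¹)` and **`covLapC_sub_lapC_eq`**: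
   `Δ^R − Δ^1⊗1 = F + Fᴴ + siteMul z`, `F = Σ_ν siteMul(−w_ν)·(∇_ν ⊗ 1)`, `z = Σ_ν [(w_νᴴw_ν)∘τ_ν⁻¹ − c(w_ν − w_ν∘τ_ν⁻¹) − c(…)ᴴ]`
   — the tier-A proof verbatim with `diagonal ↦ siteMul` (NO commutativity of colour entries is used);
 * §3 along the tower: the MATRIX-UNIT DECOMPOSITIONS `F_k = Σ_{a,b} Pmodel(V_{ab})_k ⊗ E_{ab}`, `F_kᴴ = Σ_{a,b} (Pmodel(V_{ab})_k)ᴴ ⊗ E_{ba}`,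
   `siteMul z_k = Σ_{a,b} diag(z_{ab,k}) ⊗ E_{ab}` and hence **`perturbationLaws_colourCovariantLaplacian`** from the TIER-A laws
   (`perturbationLaws_firstOrder`, `perturbationLaws_firstOrderAdjoint`, `perturbationLaws_zerothOrder`) transported along matrix units
   (`KroneckerUnits.perturbationLaws_kronUnit`, `perturbationLaws_finsetSum`) against the lifted free tower; constants × `(card o)²`;
   **`towerLimitRate_colourCovariantLaplacian`** (free tower lifted by `KroneckerLift.freeTowerLaws_kron`) and the physical value
   `t = 1` (**`colourCovariantLaplacian_rate`**) in the small-field regime `κ_col < 1`.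

HONEST FRAMING (T4-DAG p. 1).  Model-level: transporters are DATA (no group structure used), GLOBAL small field, the `−∂P∂*`/`aQ*Q`
parts of `Δ_a` NOT covariantized, finite torus, linear layer, operator norm; hypotheses are ENTRYWISE `LipschitzBackground` /
`BoundedBackground` on the connection / zeroth-order fields (derivable from matrix-norm bounds, `KroneckerUnits.norm_entry_le`); rates
/ constants OURS (crude factor `(card o)²`); NOT Bałaban's (3.23)–(3.24); NOT infinite volume / mass gap / Clay / summit progress; spine
0/9 unchanged.  HONEST DEPENDENCY: continuum YM on T⁴ ⇐ BetaPertH ∧ nine spine estimates (0/9 proved); BetaPertH ⇐ (D1) ∧ (D4) ∧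
CAP+tail; G-an2-4 gates asym, D1 and NE2/3/4.  ABSOLUTE RULE kept; no `sorry`.
-/

noncomputable section

open scoped BigOperators ComplexConjugate Matrix Matrix.Norms.L2Operator Kronecker
open Filter Topology

namespace Summit.QuantumFields.BalabanUV.T4Continuum.ColourCovariantLaplacian

open Literature.MathematicalPhysics.QuantumFieldTheory.Balaban1983to89.B5Prop11Plancherel
open Literature.MathematicalPhysics.QuantumFieldTheory.Balaban1983to89.B5G183RateUnitTower (lev lev_neZero)
open Summit.QuantumFields.BalabanUV.T4Continuum
open Summit.QuantumFields.BalabanUV.T4Continuum.CovariantAveragingTower (TowerLimitRate)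
open Summit.QuantumFields.BalabanUV.T4Continuum.BalabanAveragedTowerUnit (idx Qlev calGlev one_le_lev' cast_lev')
open Summit.QuantumFields.BalabanUV.T4Continuum.BackgroundResolventTower
open Summit.QuantumFields.BalabanUV.T4Continuum.KingPairingPlantedLaw
open Summit.QuantumFields.BalabanUV.T4Continuum.BlockPairingGeometry
open Summit.QuantumFields.BalabanUV.T4Continuum.NE2PerturbedLayer
open Summit.QuantumFields.BalabanUV.T4Continuum.FirstOrderBackgroundModel
open Summit.QuantumFields.BalabanUV.T4Continuum.PerturbationAlgebra
open Summit.QuantumFields.BalabanUV.T4Continuum.FirstOrderAdjointModel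
open Summit.QuantumFields.BalabanUV.T4Continuum.AbelianCovariantLaplacian (tauInv tauInv_tau tau_tauInv star_natCast_complex)
open Summit.QuantumFields.BalabanUV.T4Continuum.KroneckerLift
open Summit.QuantumFields.BalabanUV.T4Continuum.BlockMultiplication
open Summit.QuantumFields.BalabanUV.T4Continuum.KroneckerUnits

variable {d : ℕ} {o : Type*} [Fintype o] [DecidableEq o]

/-! ## §1 Covariant differences with colour transporters -/

section OneLevel

variable (Nf : Fin d → ℕ) [hNf : ∀ μ, NeZero (Nf μ)]

/-- **the covariant forward difference with colour transporters** `(∇^R_ν f)(x, μ) = c·(R_ν(x, μ)·f(x + e_ν, μ) − f(x, μ))`.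
[cite: Balaban1985BackgroundPropagators, (3.3) p.390 (covariant derivative, shape)] [folklore] -/
def covDc (c : ℂ) (R : Fin d → (Tor Nf × Fin d → Matrix o o ℂ)) (ν : Fin d) :
    Matrix ((Tor Nf × Fin d) × o) ((Tor Nf × Fin d) × o) ℂ :=
  c • (siteMul (R ν) * shiftM Nf ν ⊗ₖ (1 : Matrix o o ℂ) - 1)

/-- the matrix-valued connection in lattice units `w_ν = c·(R_ν − 1)`. [folklore] -/
def connM (c : ℂ) (R : Fin d → (Tor Nf × Fin d → Matrix o o ℂ)) (ν : Fin d) : Tor Nf × Fin d → Matrix o o ℂ :=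
  fun i => c • (R ν i - 1)

omit [Fintype o] [DecidableEq o] hNf in
/-- `siteMul` of a finite sum. [folklore] -/
theorem siteMul_finset_sum {σ : Type*} (s : Finset σ) (f : σ → Tor Nf × Fin d → Matrix o o ℂ) :
    ∑ x ∈ s, siteMul (f x) = siteMul (fun i => ∑ x ∈ s, f x i) := by
  classical
  induction s using Finset.induction_on with
  | empty =>
    rw [Finset.sum_empty]; ext a b; simp [siteMul_apply]
  | @insert x s hx ih =>
    rw [Finset.sum_insert hx, ih, ← siteMul_add]
    congr 1; funext i; rw [Finset.sum_insert hx]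

/-- `∇^R_ν = ∇_ν ⊗ 1 + siteMul(w_ν)·(S_ν ⊗ 1)`. [folklore] -/
theorem covDc_eq (c : ℂ) (R : Fin d → (Tor Nf × Fin d → Matrix o o ℂ)) (ν : Fin d) :
    covDc Nf c R ν = fdiff Nf c ν ⊗ₖ (1 : Matrix o o ℂ) + siteMul (connM Nf c R ν) * shiftM Nf ν ⊗ₖ (1 : Matrix o o ℂ) := by
  have e1 : siteMul (connM Nf c R ν) = c • (siteMul (R ν) - 1) := by
    unfold connM; rw [siteMul_smul, siteMul_sub, siteMul_one]
  have e2 : fdiff Nf c ν ⊗ₖ (1 : Matrix o o ℂ) = c • (shiftM Nf ν ⊗ₖ (1 : Matrix o o ℂ) - 1) := by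
    rw [fdiff, Matrix.smul_kronecker, sub_kronecker, Matrix.one_kronecker_one]
  rw [covDc, e1, e2, Matrix.smul_mul, Matrix.sub_mul, Matrix.one_mul, ← smul_add]
  congr 1; abel

/-- **the covariant vector Laplacian with colour transporters** `Δ^R = Σ_ν (∇^R_ν)ᴴ∇^R_ν`. [folklore] -/
def covLapC (c : ℂ) (R : Fin d → (Tor Nf × Fin d → Matrix o o ℂ)) : Matrix ((Tor Nf × Fin d) × o) ((Tor Nf × Fin d) × o) ℂ :=
  ∑ ν, (covDc Nf c R ν)ᴴ * covDc Nf c R ν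

/-- the free one, lifted: `Σ_ν (∇_ν ⊗ 1)ᴴ(∇_ν ⊗ 1)`. [folklore] -/
def lapC (c : ℂ) : Matrix ((Tor Nf × Fin d) × o) ((Tor Nf × Fin d) × o) ℂ :=
  ∑ ν, (fdiff Nf c ν ⊗ₖ (1 : Matrix o o ℂ))ᴴ * fdiff Nf c ν ⊗ₖ (1 : Matrix o o ℂ)

/-- `lapC = lap ⊗ 1`. [folklore] -/
theorem lapC_eq (c : ℂ) : lapC Nf c = AbelianCovariantLaplacian.lap Nf c ⊗ₖ (1 : Matrix o o ℂ) := by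
  rw [lapC, AbelianCovariantLaplacian.lap, sum_kronecker]
  refine Finset.sum_congr rfl fun ν _ => ?_
  rw [kron_mul, kron_conjTranspose]

/-- the zeroth-order colour field `z = Σ_ν [(w_νᴴw_ν)∘τ_ν⁻¹ − c(w_ν − w_ν∘τ_ν⁻¹) − c(w_ν − w_ν∘τ_ν⁻¹)ᴴ]`. [folklore] -/
def zfieldC (c : ℂ) (R : Fin d → (Tor Nf × Fin d → Matrix o o ℂ)) : Tor Nf × Fin d → Matrix o o ℂ := fun i =>
  ∑ ν, ((connM Nf c R ν (tauInv Nf ν i))ᴴ * connM Nf c R ν (tauInv Nf ν i)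
    - c • (connM Nf c R ν i - connM Nf c R ν (tauInv Nf ν i)) - c • (connM Nf c R ν i - connM Nf c R ν (tauInv Nf ν i))ᴴ)

/-- the first-order colour fields `−w_ν`. [folklore] -/
def negConnM (c : ℂ) (R : Fin d → (Tor Nf × Fin d → Matrix o o ℂ)) : Fin d → (Tor Nf × Fin d → Matrix o o ℂ) :=
  fun ν i => -(connM Nf c R ν i)

end OneLevel

/-! ## §2 The exact decomposition (real lattice factor) -/

section Level

variable (n : ℕ) [NeZero n] (M : Fin d → ℕ) [hM : ∀ μ, NeZero (M μ)]

/-- `(S⊗1)ᴴ·(siteMul w·(S⊗1)) = siteMul (w ∘ τ⁻¹)`. [folklore] -/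
theorem conjKronShift_mul_siteMul_mul_kronShift (ν : Fin d) (w : Tor (fine n M) × Fin d → Matrix o o ℂ) :
    (shiftM (fine n M) ν ⊗ₖ (1 : Matrix o o ℂ))ᴴ * (siteMul w * shiftM (fine n M) ν ⊗ₖ (1 : Matrix o o ℂ))
      = siteMul (fun i => w (tauInv (fine n M) ν i)) := by
  have h := conjKronShift_siteMul (fine n M) ν (fun i => w (tauInv (fine n M) ν i)) (o := o)
  have e : ((fun i => w (tauInv (fine n M) ν i)) ∘ tau (fine n M) ν) = w :=
    funext fun i => by simp only [Function.comp_apply, tauInv_tau]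
  rw [e] at h
  rw [← Matrix.mul_assoc]; exact h

/-- **`(∇⊗1)ᴴ·siteMul(w)·(S⊗1) = −siteMul(w)·(∇⊗1) − c·(siteMul w − siteMul (w∘τ⁻¹))`** (real `c = n`). [folklore] -/
theorem kronFdiffH_mul_siteMul_shift (ν : Fin d) (w : Tor (fine n M) × Fin d → Matrix o o ℂ) :
    (fdiff (fine n M) ((n : ℕ) : ℂ) ν ⊗ₖ (1 : Matrix o o ℂ))ᴴ * (siteMul w * shiftM (fine n M) ν ⊗ₖ (1 : Matrix o o ℂ))
      = -(siteMul w * fdiff (fine n M) ((n : ℕ) : ℂ) ν ⊗ₖ (1 : Matrix o o ℂ))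
        - ((n : ℕ) : ℂ) • (siteMul w - siteMul (fun i => w (tauInv (fine n M) ν i))) := by
  have e2 : fdiff (fine n M) ((n : ℕ) : ℂ) ν ⊗ₖ (1 : Matrix o o ℂ) = ((n : ℕ) : ℂ) • (shiftM (fine n M) ν ⊗ₖ (1 : Matrix o o ℂ) - 1) := by
    rw [fdiff, Matrix.smul_kronecker, sub_kronecker, Matrix.one_kronecker_one]
  rw [e2, Matrix.conjTranspose_smul, star_natCast_complex, Matrix.conjTranspose_sub, Matrix.conjTranspose_one, Matrix.smul_mul,
    Matrix.sub_mul, Matrix.one_mul, conjKronShift_mul_siteMul_mul_kronShift, Matrix.mul_smul, Matrix.mul_sub, Matrix.mul_one]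
  simp only [smul_sub]
  abel

/-- `(siteMul w (S⊗1))ᴴ·(siteMul w (S⊗1)) = siteMul ((wᴴw) ∘ τ⁻¹)`. [folklore] -/
theorem siteMul_shift_sq (ν : Fin d) (w : Tor (fine n M) × Fin d → Matrix o o ℂ) :
    (siteMul w * shiftM (fine n M) ν ⊗ₖ (1 : Matrix o o ℂ))ᴴ * (siteMul w * shiftM (fine n M) ν ⊗ₖ (1 : Matrix o o ℂ))
      = siteMul (fun i => (w (tauInv (fine n M) ν i))ᴴ * w (tauInv (fine n M) ν i)) := by
  rw [Matrix.conjTranspose_mul, siteMul_conjTranspose, Matrix.mul_assoc, ← Matrix.mul_assoc (siteMul fun i => (w i)ᴴ) (siteMul w),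
    siteMul_mul]
  exact conjKronShift_mul_siteMul_mul_kronShift n M ν (fun i => (w i)ᴴ * w i)

/-- per direction: `(∇^R_ν)ᴴ∇^R_ν − (∇_ν⊗1)ᴴ(∇_ν⊗1) = siteMul(−w)(∇⊗1) + (siteMul(−w)(∇⊗1))ᴴ + [siteMul((wᴴw)∘τ⁻¹) − c(D − D₋) − c(D − D₋)ᴴ]`.
[folklore] -/
theorem covDc_sq_sub_dir (R : Fin d → (Tor (fine n M) × Fin d → Matrix o o ℂ)) (ν : Fin d) :
    (covDc (fine n M) ((n : ℕ) : ℂ) R ν)ᴴ * covDc (fine n M) ((n : ℕ) : ℂ) R ν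
        - (fdiff (fine n M) ((n : ℕ) : ℂ) ν ⊗ₖ (1 : Matrix o o ℂ))ᴴ * fdiff (fine n M) ((n : ℕ) : ℂ) ν ⊗ₖ (1 : Matrix o o ℂ)
      = siteMul (negConnM (fine n M) ((n : ℕ) : ℂ) R ν) * fdiff (fine n M) ((n : ℕ) : ℂ) ν ⊗ₖ (1 : Matrix o o ℂ)
        + (siteMul (negConnM (fine n M) ((n : ℕ) : ℂ) R ν) * fdiff (fine n M) ((n : ℕ) : ℂ) ν ⊗ₖ (1 : Matrix o o ℂ))ᴴ
        + (siteMul (fun i => (connM (fine n M) ((n : ℕ) : ℂ) R ν (tauInv (fine n M) ν i))ᴴ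
              * connM (fine n M) ((n : ℕ) : ℂ) R ν (tauInv (fine n M) ν i))
            - ((n : ℕ) : ℂ) • (siteMul (connM (fine n M) ((n : ℕ) : ℂ) R ν)
                - siteMul (fun i => connM (fine n M) ((n : ℕ) : ℂ) R ν (tauInv (fine n M) ν i)))
            - ((n : ℕ) : ℂ) • (siteMul (connM (fine n M) ((n : ℕ) : ℂ) R ν)
                - siteMul (fun i => connM (fine n M) ((n : ℕ) : ℂ) R ν (tauInv (fine n M) ν i)))ᴴ) := by
  set c : ℂ := ((n : ℕ) : ℂ) with hc
  set w := connM (fine n M) c R ν with hw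
  set S := shiftM (fine n M) ν ⊗ₖ (1 : Matrix o o ℂ) with hS
  set D := siteMul w with hD
  set G := fdiff (fine n M) c ν ⊗ₖ (1 : Matrix o o ℂ) with hG
  have hneg : siteMul (negConnM (fine n M) c R ν) = -D := by
    rw [hD, ← siteMul_neg]; rfl
  have hB : Gᴴ * (D * S) = -(D * G) - c • (D - siteMul (fun i => w (tauInv (fine n M) ν i))) :=
    kronFdiffH_mul_siteMul_shift n M ν w
  have hBt : (D * S)ᴴ * G = (-(D * G) - c • (D - siteMul (fun i => w (tauInv (fine n M) ν i))))ᴴ := by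
    rw [← hB, Matrix.conjTranspose_mul Gᴴ (D * S), Matrix.conjTranspose_conjTranspose]
  have hC : (D * S)ᴴ * (D * S) = siteMul (fun i => (w (tauInv (fine n M) ν i))ᴴ * w (tauInv (fine n M) ν i)) :=
    siteMul_shift_sq n M ν w
  rw [covDc_eq, ← hG, ← hw, ← hD, ← hS, Matrix.conjTranspose_add, Matrix.add_mul, Matrix.mul_add, Matrix.mul_add, hBt, hB, hC, hneg,
    Matrix.conjTranspose_sub, Matrix.conjTranspose_neg, Matrix.conjTranspose_smul, star_natCast_complex, Matrix.neg_mul,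
    Matrix.conjTranspose_neg]
  abel

/-- **THE EXACT DECOMPOSITION `Δ^R − Δ^1⊗1 = F + Fᴴ + siteMul z`**, `F = Σ_ν siteMul(−w_ν)·(∇_ν ⊗ 1)`. [folklore] -/
theorem covLapC_sub_lapC_eq (R : Fin d → (Tor (fine n M) × Fin d → Matrix o o ℂ)) :
    covLapC (fine n M) ((n : ℕ) : ℂ) R - lapC (fine n M) ((n : ℕ) : ℂ)
      = (∑ ν, siteMul (negConnM (fine n M) ((n : ℕ) : ℂ) R ν) * fdiff (fine n M) ((n : ℕ) : ℂ) ν ⊗ₖ (1 : Matrix o o ℂ))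
        + (∑ ν, siteMul (negConnM (fine n M) ((n : ℕ) : ℂ) R ν) * fdiff (fine n M) ((n : ℕ) : ℂ) ν ⊗ₖ (1 : Matrix o o ℂ))ᴴ
        + siteMul (zfieldC (fine n M) ((n : ℕ) : ℂ) R) := by
  rw [covLapC, lapC, ← Finset.sum_sub_distrib, Finset.sum_congr rfl fun ν _ => covDc_sq_sub_dir n M R ν, Finset.sum_add_distrib,
    Finset.sum_add_distrib, ← Matrix.conjTranspose_sum]
  congr 1
  unfold zfieldC
  rw [← siteMul_finset_sum]
  refine Finset.sum_congr rfl fun ν _ => ?_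
  simp only [Matrix.conjTranspose_sub, siteMul_conjTranspose, ← siteMul_sub, ← siteMul_smul]

end Level

/-! ## §3 Along the tower: matrix-unit decomposition, `PerturbationLaws` from tier A, the η-rate -/

section Tower

variable (L : ℕ) [NeZero L] (M : Fin d → ℕ) [hM : ∀ μ, NeZero (M μ)] (a : ℝ) (ha : 0 < a)

/-- the perturbation family `P_k = Δ^{R_k} − Δ^1 ⊗ 1` at spacing `L^{−k}`. [folklore] -/
def covPertC (R : (k : ℕ) → Fin d → (idx L M k → Matrix o o ℂ)) (k : ℕ) : Matrix (idx L M k × o) (idx L M k × o) ℂ :=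
  covLapC (fine (lev L k) M) ((lev L k : ℕ) : ℂ) (R k) - lapC (fine (lev L k) M) ((lev L k : ℕ) : ℂ)

/-- the scalar first-order coefficient towers `V_{ab}`: the `(a, b)` entries of `−w^{(k)}`. [folklore] -/
def Vab (R : (k : ℕ) → Fin d → (idx L M k → Matrix o o ℂ)) (p : o × o) (k : ℕ) : Fin d → (idx L M k → ℂ) :=
  fun ν i => negConnM (fine (lev L k) M) ((lev L k : ℕ) : ℂ) (R k) ν i p.1 p.2

/-- the scalar zeroth-order coefficient towers `z_{ab}`. [folklore] -/
def Zab (R : (k : ℕ) → Fin d → (idx L M k → Matrix o o ℂ)) (p : o × o) (k : ℕ) : idx L M k → ℂ :=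
  fun i => zfieldC (fine (lev L k) M) ((lev L k : ℕ) : ℂ) (R k) i p.1 p.2

/-- the three matrix-unit pieces. [folklore] -/
def pieceF (R : (k : ℕ) → Fin d → (idx L M k → Matrix o o ℂ)) (p : o × o) (k : ℕ) : Matrix (idx L M k × o) (idx L M k × o) ℂ :=
  Pmodel L M (Vab L M R p) k ⊗ₖ Matrix.single p.1 p.2 (1 : ℂ)

/-- adjoint pieces. [folklore] -/
def pieceA (R : (k : ℕ) → Fin d → (idx L M k → Matrix o o ℂ)) (p : o × o) (k : ℕ) : Matrix (idx L M k × o) (idx L M k × o) ℂ :=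
  (Pmodel L M (Vab L M R p) k)ᴴ ⊗ₖ Matrix.single p.2 p.1 (1 : ℂ)

/-- zeroth-order pieces. [folklore] -/
def pieceZ (R : (k : ℕ) → Fin d → (idx L M k → Matrix o o ℂ)) (p : o × o) (k : ℕ) : Matrix (idx L M k × o) (idx L M k × o) ℂ :=
  Matrix.diagonal (Zab L M R p k) ⊗ₖ Matrix.single p.1 p.2 (1 : ℂ)

/-- **THE MATRIX-UNIT DECOMPOSITION OF `P_k`**: `P_k = Σ_p pieceF p k + Σ_p pieceA p k + Σ_p pieceZ p k` (`p` over `o × o`). [folklore] -/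
theorem covPertC_eq (R : (k : ℕ) → Fin d → (idx L M k → Matrix o o ℂ)) (k : ℕ) :
    covPertC L M R k = (∑ p : o × o, pieceF L M R p k) + (∑ p : o × o, pieceA L M R p k) + ∑ p : o × o, pieceZ L M R p k := by
  have hF : ∑ ν, siteMul (negConnM (fine (lev L k) M) ((lev L k : ℕ) : ℂ) (R k) ν) * fdiff (fine (lev L k) M) ((lev L k : ℕ) : ℂ) ν
        ⊗ₖ (1 : Matrix o o ℂ) = ∑ p : o × o, pieceF L M R p k := by
    rw [Fintype.sum_prod_type]
    simp_rw [siteMul_mul_kron_eq_sum]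
    conv_lhs => rw [Finset.sum_comm]
    refine Finset.sum_congr rfl fun a _ => ?_
    conv_lhs => rw [Finset.sum_comm]
    refine Finset.sum_congr rfl fun b _ => ?_
    simp only [pieceF, Pmodel, firstOrder, sum_kronecker]
    rfl
  have hA : (∑ p : o × o, pieceF L M R p k)ᴴ = ∑ p : o × o, pieceA L M R p k := by
    rw [Matrix.conjTranspose_sum]
    refine Finset.sum_congr rfl fun p _ => ?_
    rw [pieceF, pieceA, Matrix.conjTranspose_kronecker, conjTranspose_single_one]
  have hZ : siteMul (zfieldC (fine (lev L k) M) ((lev L k : ℕ) : ℂ) (R k)) = ∑ p : o × o, pieceZ L M R p k := by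
    rw [siteMul_eq_sum_kron_single, ← Fintype.sum_prod_type']
    rfl
  rw [covPertC, covLapC_sub_lapC_eq, hF, hA, hZ]

/-- the Neumann constant of the colour covariant Laplacian `κ_col = (card o)²·(2d(α + β)Cst + α′Cst)`. [folklore] -/
def kappaCol (o : Type*) [Fintype o] (d : ℕ) (a α β α' : ℝ) : ℝ :=
  (Fintype.card o : ℝ) ^ 2 * (2 * (d * (α + β) * Cst d a) + α' * Cst d a)

/-- its consistency constant `C₂^col = (card o)²·(C₂ + C₂ᴴ + Cst²β′)`. [folklore] -/
def C2col (o : Type*) [Fintype o] (d L : ℕ) (a α β β' : ℝ) : ℝ :=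
  (Fintype.card o : ℝ) ^ 2 * (C2model d L a α β + C2adj d L a α β + Cst d a * β' * Cst d a)

/-- **`PerturbationLaws` FOR THE NON-ABELIAN COVARIANT LAPLACIAN** (`d ≥ 1`), against the LIFTED free tower `Δ_a ⊗ 1`, King's
pairing `J ⊗ 1`: from ENTRYWISE `LipschitzBackground` of `−w` (`α, β`) and `BoundedBackground` of `z` (`α′, β′`),
`κ = κ_col`, `e₂ k = C₂^col·L^{−k}`.  Proof: tier-A laws per matrix unit, summed. [folklore] -/
theorem perturbationLaws_colourCovariantLaplacian (hd : 1 ≤ d) {R : (k : ℕ) → Fin d → (idx L M k → Matrix o o ℂ)}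
    {α β α' β' : ℝ} (hV : ∀ p : o × o, LipschitzBackground L M (Vab L M R p) α β)
    (hz : ∀ p : o × o, BoundedBackground L M (Zab L M R p) α' β') :
    PerturbationLaws (fun k => calDalev L M a ha k ⊗ₖ (1 : Matrix o o ℂ)) (covPertC L M R)
      (fun k => JpcT L M k ⊗ₖ (1 : Matrix o o ℂ)) (kappaCol o d a α β α') (fun k => C2col o d L a α β β' * ((L : ℝ)⁻¹) ^ k) := by
  have hF : PerturbationLaws (fun k => calDalev L M a ha k ⊗ₖ (1 : Matrix o o ℂ)) (fun k => ∑ p : o × o, pieceF L M R p k)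
      (fun k => JpcT L M k ⊗ₖ (1 : Matrix o o ℂ)) (∑ _p : o × o, d * (α + β) * Cst d a)
      (fun k => ∑ _p : o × o, C2model d L a α β * ((L : ℝ)⁻¹) ^ k) :=
    perturbationLaws_finsetSum _ fun p _ => perturbationLaws_kronUnit (perturbationLaws_firstOrder L M a ha hd (hV p)) p.1 p.2
  have hA : PerturbationLaws (fun k => calDalev L M a ha k ⊗ₖ (1 : Matrix o o ℂ)) (fun k => ∑ p : o × o, pieceA L M R p k)
      (fun k => JpcT L M k ⊗ₖ (1 : Matrix o o ℂ)) (∑ _p : o × o, d * (α + β) * Cst d a)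
      (fun k => ∑ _p : o × o, C2adj d L a α β * ((L : ℝ)⁻¹) ^ k) :=
    perturbationLaws_finsetSum _ fun p _ => perturbationLaws_kronUnit (perturbationLaws_firstOrderAdjoint L M a ha hd (hV p)) p.2 p.1
  have hZ : PerturbationLaws (fun k => calDalev L M a ha k ⊗ₖ (1 : Matrix o o ℂ)) (fun k => ∑ p : o × o, pieceZ L M R p k)
      (fun k => JpcT L M k ⊗ₖ (1 : Matrix o o ℂ)) (∑ _p : o × o, α' * Cst d a)
      (fun k => ∑ _p : o × o, Cst d a * β' * Cst d a * ((L : ℝ)⁻¹) ^ k) :=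
    perturbationLaws_finsetSum _ fun p _ => perturbationLaws_kronUnit (perturbationLaws_zerothOrder L M a ha (hz p)) p.1 p.2
  have h := perturbationLaws_add (perturbationLaws_add hF hA) hZ
  have e : covPertC L M R = fun k => (∑ p : o × o, pieceF L M R p k) + (∑ p : o × o, pieceA L M R p k) + ∑ p : o × o, pieceZ L M R p k :=
    funext fun k => covPertC_eq L M R k
  rw [e]
  refine perturbationLaws_mono h (le_of_eq ?_) fun k => le_of_eq ?_
  · simp only [Finset.sum_const, Finset.card_univ, Fintype.card_prod, kappaCol]; ring
  · simp only [Finset.sum_const, Finset.card_univ, Fintype.card_prod, C2col]; ring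

/-- **η-RATE FOR THE NON-ABELIAN COVARIANT-LAPLACIAN COUPLING** (`L ≥ 2`, `d ≥ 1`): the (lifted) King-averaged unit-lattice covariances
of `(Δ_a^{(k)}⊗1 + t(Δ^{R_k} − Δ^1⊗1))⁻¹` converge with rate `L^{−k}` for every `‖t‖κ_col < 1`. [cite: King1986, Lemma 4.5 (4.32)/(4.38)
p.674; Balaban1985BackgroundPropagators, (3.3) p.390 (shape)] [folklore] -/
theorem towerLimitRate_colourCovariantLaplacian (hL : 2 ≤ L) (hd : 1 ≤ d) {R : (k : ℕ) → Fin d → (idx L M k → Matrix o o ℂ)}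
    {α β α' β' : ℝ} (hV : ∀ p : o × o, LipschitzBackground L M (Vab L M R p) α β)
    (hz : ∀ p : o × o, BoundedBackground L M (Zab L M R p) α' β') {t : ℂ} (ht : ‖t‖ * kappaCol o d a α β α' < 1) :
    TowerLimitRate (fun k => Qlev L M k ⊗ₖ (1 : Matrix o o ℂ)) ((L : ℝ) ^ d)
      (fun k => (calDalev L M a ha k ⊗ₖ (1 : Matrix o o ℂ) + t • covPertC L M R k)⁻¹)
      (Cpert (kappaCol o d a α β α') (2 * d * Cst d a) (CJ d a) (C2col o d L a α β β') 0 t) ((L : ℝ)⁻¹) := by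
  have hL1 : (1 : ℝ) < L := by exact_mod_cast (lt_of_lt_of_le one_lt_two hL : 1 < L)
  have hr : (0 : ℝ) < (L : ℝ) ^ d := pow_pos (lt_trans zero_lt_one hL1) d
  refine towerLimitRate_perturbed hr (freeTowerLaws_kron o (freeTowerLaws_king L M a ha))
    (perturbationLaws_colourCovariantLaplacian L M a ha hd hV hz) (inv_lt_one_of_one_lt₀ hL1)
    (fun k => le_rfl) (fun k => le_rfl) (fun k => le_rfl) (fun k => ?_) ht
  simp only [zero_mul, le_refl]

/-- **THE PHYSICAL VALUE `t = 1`** in the small-field regime `κ_col < 1`. [folklore] -/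
theorem colourCovariantLaplacian_rate (hL : 2 ≤ L) (hd : 1 ≤ d) {R : (k : ℕ) → Fin d → (idx L M k → Matrix o o ℂ)}
    {α β α' β' : ℝ} (hV : ∀ p : o × o, LipschitzBackground L M (Vab L M R p) α β)
    (hz : ∀ p : o × o, BoundedBackground L M (Zab L M R p) α' β') (hsmall : kappaCol o d a α β α' < 1) :
    TowerLimitRate (fun k => Qlev L M k ⊗ₖ (1 : Matrix o o ℂ)) ((L : ℝ) ^ d)
      (fun k => (calDalev L M a ha k ⊗ₖ (1 : Matrix o o ℂ) + covPertC L M R k)⁻¹)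
      (Cpert (kappaCol o d a α β α') (2 * d * Cst d a) (CJ d a) (C2col o d L a α β β') 0 1) ((L : ℝ)⁻¹) := by
  have h := towerLimitRate_colourCovariantLaplacian L M a ha hL hd hV hz (t := 1) (by rwa [norm_one, one_mul])
  simpa only [one_smul] using h

/-! ### Matrix-norm hypotheses ⇒ the entrywise ones -/

/-- MATRIX-LEVEL Lipschitz background: colour-matrix coefficient fields with `‖W‖ ≤ α`, lattice-Lipschitz and two-spacing
consistent in OPERATOR NORM (constant `β`). [folklore] -/
structure LipschitzBackgroundM (W : (k : ℕ) → Fin d → (idx L M k → Matrix o o ℂ)) (α β : ℝ) : Prop where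
  /-- `α, β ≥ 0` -/
  nonneg : 0 ≤ α ∧ 0 ≤ β
  /-- size -/
  bound : ∀ k μ i, ‖W k μ i‖ ≤ α
  /-- Lipschitz at spacing `L^{−k}` -/
  lipschitz : ∀ k μ ν i, ‖W k μ (tau (fine (lev L k) M) ν i) - W k μ i‖ ≤ β / (lev L k : ℕ)
  /-- two-spacing consistency at the block parent -/
  consistent : ∀ k μ (i : idx L M (k + 1)), ‖W (k + 1) μ i - W k μ (parT (lev L k) L M i)‖ ≤ β / (lev L k : ℕ)

/-- MATRIX-LEVEL bounded consistent zeroth-order field. [folklore] -/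
structure BoundedBackgroundM (Z : (k : ℕ) → (idx L M k → Matrix o o ℂ)) (α β : ℝ) : Prop where
  /-- `α, β ≥ 0` -/
  nonneg : 0 ≤ α ∧ 0 ≤ β
  /-- size -/
  bound : ∀ k i, ‖Z k i‖ ≤ α
  /-- two-spacing consistency at the block parent -/
  consistent : ∀ k (i : idx L M (k + 1)), ‖Z (k + 1) i - Z k (parT (lev L k) L M i)‖ ≤ β / (lev L k : ℕ)

omit [NeZero L] hM in
/-- entries inherit the matrix-level hypotheses (`|X a b| ≤ ‖X‖`). [folklore] -/
theorem lipschitzBackground_entry {W : (k : ℕ) → Fin d → (idx L M k → Matrix o o ℂ)} {α β : ℝ}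
    (h : LipschitzBackgroundM L M W α β) (p : o × o) : LipschitzBackground L M (fun k ν i => W k ν i p.1 p.2) α β where
  nonneg := h.nonneg
  bound := fun k μ i => (norm_entry_le _ p.1 p.2).trans (h.bound k μ i)
  lipschitz := fun k μ ν i => by
    rw [← Matrix.sub_apply]; exact (norm_entry_le _ p.1 p.2).trans (h.lipschitz k μ ν i)
  consistent := fun k μ i => by
    rw [← Matrix.sub_apply]; exact (norm_entry_le _ p.1 p.2).trans (h.consistent k μ i)

omit [NeZero L] hM in
/-- entries inherit the matrix-level hypotheses, zeroth order. [folklore] -/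
theorem boundedBackground_entry {Z : (k : ℕ) → (idx L M k → Matrix o o ℂ)} {α β : ℝ} (h : BoundedBackgroundM L M Z α β)
    (p : o × o) : BoundedBackground L M (fun k i => Z k i p.1 p.2) α β where
  nonneg := h.nonneg
  bound := fun k i => (norm_entry_le _ p.1 p.2).trans (h.bound k i)
  consistent := fun k i => by
    rw [← Matrix.sub_apply]; exact (norm_entry_le _ p.1 p.2).trans (h.consistent k i)

/-- **THE NON-ABELIAN η-RATE FROM MATRIX-NORM HYPOTHESES** (`L ≥ 2`, `d ≥ 1`, `t = 1`): if the connection `−w^{(k)} = −L^k(R^{(k)} − 1)`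
is a `LipschitzBackgroundM (α, β)` and the zeroth-order field `z^{(k)}` a `BoundedBackgroundM (α′, β′)` with `κ_col < 1`, the lifted
King-averaged unit-lattice covariances of `(Δ_a^{(k)}⊗1 + Δ^{R_k} − Δ^1⊗1)⁻¹` converge with rate `L^{−k}`. [folklore] -/
theorem colourCovariantLaplacian_rate_of_matrixBounds (hL : 2 ≤ L) (hd : 1 ≤ d) {R : (k : ℕ) → Fin d → (idx L M k → Matrix o o ℂ)}
    {α β α' β' : ℝ}
    (hV : LipschitzBackgroundM L M (fun k ν i => negConnM (fine (lev L k) M) ((lev L k : ℕ) : ℂ) (R k) ν i) α β)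
    (hz : BoundedBackgroundM L M (fun k i => zfieldC (fine (lev L k) M) ((lev L k : ℕ) : ℂ) (R k) i) α' β')
    (hsmall : kappaCol o d a α β α' < 1) :
    TowerLimitRate (fun k => Qlev L M k ⊗ₖ (1 : Matrix o o ℂ)) ((L : ℝ) ^ d)
      (fun k => (calDalev L M a ha k ⊗ₖ (1 : Matrix o o ℂ) + covPertC L M R k)⁻¹)
      (Cpert (kappaCol o d a α β α') (2 * d * Cst d a) (CJ d a) (C2col o d L a α β β') 0 1) ((L : ℝ)⁻¹) :=
  colourCovariantLaplacian_rate L M a ha hL hd (fun p => lipschitzBackground_entry L M hV p) (fun p => boundedBackground_entry L M hz p)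
    hsmall

end Tower


end Summit.QuantumFields.BalabanUV.T4Continuum.ColourCovariantLaplacian

end
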